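import Summits.BirchSwinnertonDyer.BirchSwinnertonDyer.Theorems.SylvesterTwoHeegnerIndexUpperOffV0CebotarevTwo
import HarnessLib

/-!
# K7t crux `UpperOffV0HSY` (item 19581): McCallum's Step B at `p = 2` WITH A SHEAR, for the CM
# curves `y² = x³ − c`

Route `SylvesterTwoHeegnerIndex` (cell bsd-cm, rung K7t), line `offv0-kolyvagin2` on
stmt-BirchSwinnertonDyer-19581.  The parity-free abstract count `…UpperOffV0DescentDefect`
(`claimB_indep_defect'`, `descent_defect'`) needs, beyond the `cebotarev` field of
`KolyvaginDescent.HypothesesM` (Cor. 3.2 for INDEPENDENT `τ`-eigenclasses — at `2`: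
`exists_kolyvaginPrime_gt_twoPow`, p448972/p449935), ONE more instance `hceb₁`: Cor. 3.2 for an
eigen-family `{x, s, d}` in which `ℤ d` and `ℤ x` share their `2`-socle.  The Galois element behind
it is supplied here:

* `exists_h1Eval_conj_mul_order_two_shear` — **Step B at `2` with a shear**: the tree's Step B at
  `2` (`exists_h1Eval_conj_mul_order_two`, p448442) asks McCallum-independence of the eigen-family
  `xs` itself; here independence is asked only of the SHEARED family `xs i − a i • xs i₀` along one
  member `xs i₀` whose prescribed local order is `2^0` (the sheared classes need not be
  eigenclasses: McCallum's (2) at `2`, `exists_h1Eval_eq_of_indep_twoPow` p447504, prescribes the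
  values `[xs i − a_i xs i₀, ρ]`, and `[xs i₀, ρ] = 0` makes them the values `[xs i, ρ]`).

The Čebotarev assembly (Cor. 3.2 with a shear) and the socle configuration of Claim B are in
`…UpperOffV0CebotarevTwoShear`.  NOT the crux (B14 = O12 open as a class).
-/

noncomputable section

open scoped Classical
open Field WeierstrassCurve NumberField IsDedekindDomain Literature.NumberTheory.EllipticCurves
  Literature.NumberTheory.GaloisRepresentations

set_option autoImplicit false
set_option linter.dupNamespace false

namespace Summit.BirchSwinnertonDyer.BirchSwinnertonDyer.Theorems.SylvesterTwoUpper

universe u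

/-! ## §1 Step B at `2` with a shear -/

section StepBShear

variable {K : Type u} [Field K] [NumberField K] (W : WeierstrassCurve ℚ) [W.IsElliptic]
  {σ : K ≃ₐ[ℚ] K} {τ : AlgebraicClosure K ≃+* AlgebraicClosure K}

/-- **McCallum's Prop. 3.1 / Cor. 3.2, Step B, at `p = 2`, with a shear.**  As the tree's
`exists_h1Eval_conj_mul_order_two` (a `ℚ`-model `W` of `y² = x³ − c` over `K` with `∛c ∉ K`,
`ω ∉ K`; an involutive lift `τ` of `σ` with `τ(ω) = ω²`; `σ`-eigenclasses `x_i ∈ H¹(K, E[2^M])`;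
targets `N_i ≤ min(e_i, M)`), except that McCallum-independence (`∑ bᵢ zᵢ = 0 ⟹ 2^{eᵢ} ∣ bᵢ`) is
asked of the SHEARED family `z_i = x_i − a_i x_{i₀}` (`a_{i₀} = 0`) along a member `x_{i₀}` with
target `N_{i₀} = 0`, and `2^{e_i} z_i = 0`.  Conclusion unchanged: `ρ ∈ Γ_{K(E[2^M])}` with
`ord [x_i, (ρm)^τ(ρm)] = 2^{N_i}` exactly for all `m ∈ 𝒩`.  Proof: McCallum's (2) at `2` for the
`z_i` with the values `v_i = ∓2^{M−N_i}[ω]P` of the tree's proof; `v_{i₀} = ∓2^M[ω]P = 0`, so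
`[x_i, ρ] = [z_i, ρ] + a_i[x_{i₀}, ρ] = v_i`, and the rest is the tree's computation verbatim.
[cite: McCallumLMS1991, §3 Prop. 3.1 and Cor. 3.2 (proof)] -/
theorem exists_h1Eval_conj_mul_order_two_shear {C : VariableChange ℚ} {c : ℚ}
    (hCW : C • W = ⟨0, 0, 0, 0, -c⟩) (hc : ∀ x : K, x ^ 3 ≠ (c : K))
    (hωK : ∀ x : K, x ^ 2 + x + 1 ≠ 0)
    (hτ : IsLiftOfAut σ τ) (hinv : ∀ x, τ (τ x) = x)
    {ω : AlgebraicClosure K} (hω : ω ^ 2 + ω + 1 = 0) (hτω : τ ω = ω ^ 2)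
    {M : ℕ} (hM : 1 ≤ M)
    {ι : Type*} [Fintype ι] {xs : ι → galH1Torsion (W.baseChange K) ((2 ^ M : ℕ) : ℤ)} {ν : ι → ℤ}
    (hν : ∀ i, ν i = 1 ∨ ν i = -1) (hxs : ∀ i, conjAct W σ ((2 ^ M : ℕ) : ℤ) (xs i) = ν i • xs i)
    (i₀ : ι) (a : ι → ℤ) (ha : a i₀ = 0)
    (e : ι → ℕ) (he : ∀ i, ((2 : ℤ) ^ e i) • (xs i - a i • xs i₀) = 0)
    (hind : ∀ b : ι → ℤ, ∑ i, b i • (xs i - a i • xs i₀) = 0 → ∀ i, ((2 : ℤ) ^ e i) ∣ b i)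
    (Nv : ι → ℕ) (hNe : ∀ i, Nv i ≤ e i) (hNM : ∀ i, Nv i ≤ M) (hN₀ : Nv i₀ = 0) :
    ∃ ρ ∈ torsionFixing (W.baseChange K) ((2 ^ M : ℕ) : ℤ),
      ∀ m ∈ evalKer (W.baseChange K) ((2 ^ M : ℕ) : ℤ) xs, ∀ i,
      ((2 : ℤ) ^ Nv i) • h1Eval (W.baseChange K) ((2 ^ M : ℕ) : ℤ) (xs i)
          (hτ.conjGalCMH (ρ * m) * (ρ * m)) = 0 ∧
      (Nv i ≠ 0 → ((2 : ℤ) ^ (Nv i - 1)) • h1Eval (W.baseChange K) ((2 ^ M : ℕ) : ℤ) (xs i)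
          (hτ.conjGalCMH (ρ * m) * (ρ * m)) ≠ 0) := by
  -- the `K`-model `B = W ×_ℚ K` of the Mordell curve
  have hCB : (C.map (algebraMap ℚ K)) • W.baseChange K = ⟨0, 0, 0, 0, -(c : K)⟩ := by
    rw [← VariableChange.baseChange_smul_eq, hCW]
    ext <;> simp [WeierstrassCurve.baseChange]
  -- `[ω]` on `E[2^M]`, semilinear for `τ`
  obtain ⟨θ, hθrel, hθτ⟩ := exists_omega_semilinear_lift W hCW hτ hω hτω
  haveI : Finite (geomTorsion (W.baseChange K) ((2 ^ M : ℕ) : ℤ)) :=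
    (W.baseChange K).finite_geomTorsion_nat (pow_ne_zero M two_ne_zero)
  have hmem : ∀ Q : geomPoints (W.baseChange K),
      Q ∈ geomTorsion (W.baseChange K) ((2 ^ M : ℕ) : ℤ) ↔ ((2 ^ M : ℕ) : ℤ) • Q = 0 := fun Q =>
    Submodule.mem_torsionBy_iff _ Q
  have hθmem : ∀ T : geomTorsion (W.baseChange K) ((2 ^ M : ℕ) : ℤ),
      θ (T : geomPoints (W.baseChange K)) ∈ geomTorsion (W.baseChange K) ((2 ^ M : ℕ) : ℤ) := by
    intro T
    rw [hmem, ← map_zsmul, (hmem _).mp T.2, map_zero]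
  let θN : geomTorsion (W.baseChange K) ((2 ^ M : ℕ) : ℤ) →+
      geomTorsion (W.baseChange K) ((2 ^ M : ℕ) : ℤ) :=
    { toFun := fun T => ⟨θ T, hθmem T⟩
      map_zero' := Subtype.ext (by
        change θ ((0 : geomTorsion (W.baseChange K) ((2 ^ M : ℕ) : ℤ)) : geomPoints (W.baseChange K))
          = (0 : geomPoints (W.baseChange K))
        rw [ZeroMemClass.coe_zero, map_zero])
      map_add' := fun T T' => Subtype.ext (by
        change θ ((T + T' : geomTorsion (W.baseChange K) ((2 ^ M : ℕ) : ℤ)) :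
          geomPoints (W.baseChange K)) = θ T + θ T'
        rw [AddMemClass.coe_add, map_add]) }
  have hθN : ∀ T, θN (θN T) + θN T + T = 0 := fun T => Subtype.ext (hθrel T)
  have hτθ : ∀ T, hτ.torsionMap W ((2 ^ M : ℕ) : ℤ) (θN T) =
      θN (θN (hτ.torsionMap W ((2 ^ M : ℕ) : ℤ) T)) := fun T => Subtype.ext (hθτ T)
  have hτ2 : ∀ T, hτ.torsionMap W ((2 ^ M : ℕ) : ℤ) (hτ.torsionMap W ((2 ^ M : ℕ) : ℤ) T) = T :=
    fun T => hτ.torsionMap_torsionMap W hinv _ T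
  -- order `4^M`, a point of order `2^M`, a `τ`-fixed generator `P`
  have hmK : ((2 ^ M : ℕ) : K) ≠ 0 := by exact_mod_cast pow_ne_zero M (two_ne_zero (α := K))
  obtain ⟨P₀, hP₀⟩ := WeierstrassCurve.exists_addOrderOf_eq (W := W.baseChange K) hmK
  have hcard : Nat.card (geomTorsion (W.baseChange K) ((2 ^ M : ℕ) : ℤ)) = 4 ^ M := by
    rw [card_geomTorsion_two_pow (W.baseChange K) two_ne_zero M, pow_mul]
    norm_num
  obtain ⟨P, hτP, hP⟩ := EisensteinTorsion.exists_tau_fixed_addOrderOf_eq θN hθN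
    (hτ.torsionMap W ((2 ^ M : ℕ) : ℤ)) hτθ hcard hP₀ hτ2 hM
  have hkill : ∀ T : geomTorsion (W.baseChange K) ((2 ^ M : ℕ) : ℤ), ((2 : ℤ) ^ M) • T = 0 :=
    fun T => by
    have := EisensteinTorsion.pow_mul_zsmul_eq_zero θN hθN hcard hP 1 T
    rwa [mul_one] at this
  -- the generator `Q = P + 2θP` of the `(-1)`-eigenline also has order `2^M`
  have hQ : addOrderOf (P + (2 : ℤ) • θN P) = 2 ^ M := by
    have e1 : P + (2 : ℤ) • θN P = (1 : ℤ) • P + (2 : ℤ) • θN P := by rw [one_zsmul]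
    rw [e1]
    exact EisensteinTorsion.addOrderOf_lin_eq_two_pow θN hθN hcard hP hM (by omega)
  -- prescribed values `v_i = s_i • θP`, `s_i = ∓2^{M-N_i}`
  let s : ι → ℤ := fun i => if ν i = 1 then -(2 : ℤ) ^ (M - Nv i) else (2 : ℤ) ^ (M - Nv i)
  let v : ι → geomTorsion (W.baseChange K) ((2 ^ M : ℕ) : ℤ) := fun i => s i • θN P
  have hvkill : ∀ i, ((2 : ℤ) ^ e i) • v i = 0 := fun i => by
    have hpow : (2 : ℤ) ^ e i * (2 : ℤ) ^ (M - Nv i) = (2 : ℤ) ^ (e i - Nv i) * (2 : ℤ) ^ M := by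
      rw [← pow_add, ← pow_add]
      have h₁ := hNe i
      have h₂ := hNM i
      congr 1
      omega
    change ((2 : ℤ) ^ e i) • (s i • θN P) = 0
    by_cases h : ν i = 1
    · have hs : s i = -(2 : ℤ) ^ (M - Nv i) := if_pos h
      rw [hs, smul_smul, mul_neg, hpow, neg_smul, mul_zsmul, hkill, smul_zero, neg_zero]
    · have hs : s i = (2 : ℤ) ^ (M - Nv i) := if_neg h
      rw [hs, smul_smul, hpow, mul_zsmul, hkill, smul_zero]
  -- the value prescribed at `i₀` vanishes: `s_{i₀} = ∓2^M`
  have hv₀ : v i₀ = 0 := by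
    change s i₀ • θN P = 0
    by_cases h : ν i₀ = 1
    · have hs : s i₀ = -(2 : ℤ) ^ (M - Nv i₀) := if_pos h
      rw [hs, hN₀, Nat.sub_zero, neg_smul, hkill, neg_zero]
    · have hs : s i₀ = (2 : ℤ) ^ (M - Nv i₀) := if_neg h
      rw [hs, hN₀, Nat.sub_zero, hkill]
  -- McCallum's (2) at `2` for the SHEARED family realises the `v_i`
  obtain ⟨ρ, hρ, hρz⟩ := exists_h1Eval_eq_of_indep_twoPow hc hωK (W.baseChange K) hCB hM
    (fun i => xs i - a i • xs i₀) e he hind v hvkill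
  -- … and then `[x_i, ρ] = v_i` as well, because `[x_{i₀}, ρ] = v_{i₀} = 0`
  have hρ₀ : h1Eval (W.baseChange K) ((2 ^ M : ℕ) : ℤ) (xs i₀) ρ = 0 := by
    have := hρz i₀
    rwa [ha, zero_zsmul, sub_zero, hv₀] at this
  have hρe : ∀ i, h1Eval (W.baseChange K) ((2 ^ M : ℕ) : ℤ) (xs i) ρ = v i := fun i => by
    have := hρz i
    rwa [show xs i - a i • xs i₀ = xs i + (-(a i)) • xs i₀ by rw [neg_zsmul, sub_eq_add_neg],
      h1Eval_add _ _ _ _ hρ, h1Eval_zsmul _ _ _ _ hρ, hρ₀, smul_zero, add_zero] at this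
  refine ⟨ρ, hρ, fun m hm i => ?_⟩
  have hρm : ρ * m ∈ torsionFixing (W.baseChange K) ((2 ^ M : ℕ) : ℤ) := mul_mem hρ hm.1
  -- `[x_i, (ρm)^τ (ρm)] = ν_i τ v_i + v_i`
  have hval : h1Eval (W.baseChange K) ((2 ^ M : ℕ) : ℤ) (xs i)
      (hτ.conjGalCMH (ρ * m) * (ρ * m)) = ν i • hτ.torsionMap W ((2 ^ M : ℕ) : ℤ) (v i) + v i := by
    rw [h1Eval_mul _ _ _ (hτ.conjGalCMH_mem_torsionFixing W hinv _ hρm),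
      hτ.h1Eval_conjGalCMH_of_eigen W hinv _ (hν i) (hxs i) hρm, h1Eval_mul _ _ _ hρ, hρe i,
      hm.2 i, add_zero]
  -- … which is `2^{M-N_i}` times the generator of the `ν_i`-eigenline
  have h2 := EisensteinTorsion.apply_apply_eq θN hθN P
  have hgen : ∀ {G : geomTorsion (W.baseChange K) ((2 ^ M : ℕ) : ℤ)}, addOrderOf G = 2 ^ M →
      ((2 : ℤ) ^ Nv i) • (((2 : ℤ) ^ (M - Nv i)) • G) = 0 ∧
      (Nv i ≠ 0 → ((2 : ℤ) ^ (Nv i - 1)) • (((2 : ℤ) ^ (M - Nv i)) • G) ≠ 0) := by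
    intro G hG
    constructor
    · rw [smul_smul, ← pow_add, Nat.add_sub_cancel' (hNM i)]
      have := addOrderOf_nsmul_eq_zero G
      rw [hG] at this
      exact_mod_cast this
    · intro hN h0
      rw [smul_smul, ← pow_add] at h0
      have hlt : Nv i - 1 + (M - Nv i) < M := by have := hNM i; omega
      have hne := nsmul_ne_zero_of_lt_addOrderOf (x := G)
        (pow_ne_zero (Nv i - 1 + (M - Nv i)) two_ne_zero)
        (by rw [hG]; exact Nat.pow_lt_pow_right (by norm_num) hlt)
      exact hne (by exact_mod_cast h0)
  rw [hval]
  rcases hν i with h | h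
  · have hs : s i = -(2 : ℤ) ^ (M - Nv i) := if_pos h
    have hw : ν i • hτ.torsionMap W ((2 ^ M : ℕ) : ℤ) (v i) + v i = ((2 : ℤ) ^ (M - Nv i)) • P := by
      change ν i • hτ.torsionMap W ((2 ^ M : ℕ) : ℤ) (s i • θN P) + s i • θN P = _
      rw [h, one_smul, hs, map_zsmul, hτθ, hτP, h2]
      simp only [smul_sub, smul_neg, neg_smul]
      module
    rw [hw]
    exact hgen hP
  · have h' : ¬ ν i = 1 := by rw [h]; norm_num
    have hs : s i = (2 : ℤ) ^ (M - Nv i) := if_neg h'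
    have hw : ν i • hτ.torsionMap W ((2 ^ M : ℕ) : ℤ) (v i) + v i =
        ((2 : ℤ) ^ (M - Nv i)) • (P + (2 : ℤ) • θN P) := by
      change ν i • hτ.torsionMap W ((2 ^ M : ℕ) : ℤ) (s i • θN P) + s i • θN P = _
      rw [h, hs, map_zsmul, hτθ, hτP, h2]
      simp only [smul_add, smul_sub, smul_neg, neg_smul, one_smul]
      module
    rw [hw]
    exact hgen hQ

end StepBShear

end Summit.BirchSwinnertonDyer.BirchSwinnertonDyer.Theorems.SylvesterTwoUpper

end
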